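import Literature.AlgebraicGeometry.Resolution.ResolutionOfSingularities
import Mathlib.AlgebraicGeometry.Morphisms.Proper
import Mathlib.AlgebraicGeometry.Pullbacks
import Mathlib.FieldTheory.IsAlgClosed.AlgebraicClosure
import Mathlib.RingTheory.Algebraic.Basic
import Mathlib.RingTheory.FiniteType
import HarnessLib

/-!
# [OURS · L1 W8.2] RESOLUTION IN FAMILIES — the FAMILY FORM of the prime-model transfer (door 2,
# `UniformComplexity` / `PrimeModelTransfer`) of slot W8.2; campaign statements, Theses-free module

Cell `res-hironaka` (run/shared/lean/pub/res-hironaka/), LADDER-RESOLUTION rung L (RESCUE), slot W8.2 of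
plan/RESCUE-SEED.md («PRIME-FIELD / UNIVERSALITY TRANSFER instead of descent: resolve over 𝔽_p or 𝔽̄_p and
transfer FAMILIES»). SECOND DOOR: route `UniformComplexity`, item `PrimeModelTransfer`
(stmt-ResolutionOfSingularities-8933: for a prime `p`, resolution of integral separated finite-type schemes over
the algebraically closed fields ALGEBRAIC over `𝔽_p` ⇒ the same over EVERY algebraically closed field of
characteristic `p`). Self-typed by the slot's prover res-L1-s82-pv-2 (gen 5) under the rung-B precedent (the
OURS typer res-L1-type-o6 may supersede docstrings; lanes A/B sign); the prover's THEOREMS about these names live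
in the sibling files `Theorems/UniformComplexityPrimeModelTransferOfFamilyResolution.lean` («⇐») and
`Theorems/UniformComplexityPrimeModelTransferFamilyResolutionSpread.lean` («⇒»). NOTHING is proved about
resolution of singularities here and nothing is asserted: two `def`s and four pure-logic anchors.

WHY THIS FILE. The route thesis reads the crux model-theoretically: «prime-model sufficiency; informally
equivalent, via ACF_p-completeness and compactness, to a uniform bound on resolution complexity over 𝔽̄_p», and
the slot's lever is the transfer of FAMILIES. The door-2 residual census of gen 0–4 (L/res-L1-s82-pv-2/
DOOR2-KERNEL.md §3(b)) recommended the UNIFORMITY form as the only remaining door-2-specific statement and rated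
it XL. This module types the uniformity form WITHOUT model theory, as a statement of algebraic geometry about
ONE algebraically closed ground field `k` (read `k = 𝔽̄_p`):

* `IsWeakResolution π` — `π : Y → X` is proper, `Y` is regular, and `π` is an isomorphism over a NON-EMPTY open
  of `X` («a resolution up to discarding the components of `Y` that do not dominate»; for irreducible `X` and
  Noetherian `Y` it yields `Scheme.HasResolution X` — the prover's
  `Theorems.PrimeModelTransfer.hasResolution_of_isIso_morphismRestrict`, p483756 — and conversely a resolution of
  a non-empty irreducible `X` is a weak resolution, anchor `isWeakResolution_of_isResolution`);
* `FamilyResolution k` — RESOLUTION IN FAMILIES over `k`: for every finitely generated `k`-domain `A` and every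
  PROPER family `f : 𝒳 → Spec A` whose geometric generic fibre is integral, there are a finite-type,
  algebraic, injective base extension `A → A'` (a domain) and ONE morphism `G : 𝒴 → 𝒳 ×_A Spec A'` whose fibre
  over EVERY field-valued point `A' → Ω` is a weak resolution of the fibre of `𝒳`. The uniformity is in the
  order of the quantifiers (`∃ A' 𝒴 G ∀ Ω φ`): with `∀ Ω φ ∃` the statement would just restate resolution of
  the fibres one at a time.

THEOREMS OF THE PROVER (NOT proved here; gen 5 targets): for a prime `p`,
`PrimeModelTransferAt p ↔ ∀ k [Field k] [CharP k p] [IsAlgClosed k], (∀ x : k, ∃ n, 0 < n ∧ x ^ p ^ n = x) →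
(integral separated finite-type `k`-schemes have resolutions) → FamilyResolution k`. «⇐»: a variety `X` over an
algebraically closed `K ⊇ 𝔽̄_p` is, after Nagata compactification and Chow's lemma, the fibre of a PROPER
(projective) family over a finitely generated `𝔽̄_p`-subalgebra `R ⊆ K` (EGA IV₃ 8.8.2 / Görtz–Wedhorn
Prop. 10.75: the closed subscheme `X ↪ ℙⁿ_K = lim_t ℙⁿ_{𝔽̄_p} × Spec 𝔽̄_p[t]` descends to a stage), the
`K`-point `R ⊆ K` lifts along the algebraic extension `A'` (Mathlib `IsAlgClosed.lift`), and the fibre of `G`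
there is a weak resolution of `X`. «⇒»: a
resolution of the geometric generic fibre `𝒳 ×_A (Frac A)^{alg}` (given by the crux) descends to a finite
extension of `Frac A` and spreads over a basic open of a finitely generated `A`-subalgebra (EGA IV₃ 8.10.5,
IV₄ 17.7.8; the tree's specialization machinery p483756 / p484634 / p522497 run at ALL points instead of one
closed point).

BUILD RULE (cell, director-resolution 2026-08-26T18:53:29Z (B)): OURS vocabulary file, THESES-FREE BY BIRTH —
imports only `Literature.AlgebraicGeometry.Resolution.ResolutionOfSingularities` (for `Scheme.IsRegular`,
`IsResolution`), Mathlib and `HarnessLib`.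

HONEST FRAMING. The `def`s below are OURS — campaign statements that REPLACE THE ROLE of a printed item of
H. Hironaka's manuscript *Resolution of singularities in positive characteristics* (2017-03-23, [Hironaka2017],
lit key `paper:url-3343fd9e678b`) — namely §17 ¶2, p.89 l.59–62: «In this work the base field K is always
assumed to be a finite field or Z/pZ because our resolution is for all dimension. When the K has transcendence
degree d we can reformulate the resolution problem to the case of dimension d + dim Z.» (typed AS PRINTED, not
asserted, as `S17Methodology.U89_2` / `U89_3`, Literature/AlgebraicGeometry/Hironaka2017/S17Methodology/). The
printed sentence reformulates a variety over a field of transcendence degree `d` as a FAMILY of dimension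
`d + dim Z` over the prime field; `FamilyResolution` says what resolving such families must deliver for the
reformulation to give back a resolution of the original variety over an ALGEBRAICALLY CLOSED field (door 2's
universe): not a resolution of the total space (whose generic fibre is only regular — barrier files
`RegularNotGeometricallyRegular.lean`, `InseparableBaseChangeResolution.lean`, `FrobeniusTwistResolution.lean`),
but a SIMULTANEOUS weak resolution of the geometric fibres over an open of the base after an algebraic base
extension. Hironaka's statements are CANDIDATES under adjudication (D-0012/D-0089); nothing here is attributed to
the author and no verdict on the manuscript is implied. AI typing, weaker than expert review.

VACUITY SELF-CHECK: `IsWeakResolution π` is satisfiable (identity of a non-empty regular scheme) and refutable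
(`X` empty). `FamilyResolution k` for `k` algebraically closed of characteristic `p`: not trivially true — at
`A = k` it contains (via the prover's «⇐» at the fibre `φ = id`) resolution of every integral proper `k`-scheme,
open in dimension `≥ 4`; not trivially false — it follows from `AlgClosedRes p` (resolution over all
algebraically closed fields of characteristic `p`, an instance of the summit conjunct) by the prover's «⇒»
spreading theorem; the hypothesis «geometric generic fibres integral» is not idle (for `𝒳 = Spec A'' → Spec A`
with `A''/A` finite of degree `> 1` no geometric fibre is integral and no weak resolution of a fibre exists —
but such families are excluded, as they must be, since their fibres over `K = K^{alg}` are never the integral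
schemes the crux speaks about).

## References (vocabulary and locators only; nothing cited as a premise)
* H. Hironaka, ms. 2017-03-23, §17 ¶2 p.89 l.59–62 — under adjudication, quoted for the role replaced, not
  asserted. [Hironaka2017]
* A. Grothendieck, J. Dieudonné, EGA IV₃ (1966) Thm. 8.8.2, 8.10.5; EGA IV₄ (1967) Prop. 17.7.8 — spreading out
  (docstring vocabulary for the prover's theorems). [EGAIV3]
* The Stacks Project, Tags 01ZM, 081F, 054K. [StacksProject]
* Theses/UniformComplexity.lean item stmt-8933 (route text: «informally equivalent, via ACF_p-completeness and
  compactness, to a uniform bound on resolution complexity over F_p-bar»); L/res-L1-s82-pv-2/DOOR2-KERNEL.md §3(b)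
  — cell files, OURS.
-/

noncomputable section

set_option linter.dupNamespace false -- mandated namespace of this single-conjunct summit

open _root_.CategoryTheory _root_.CategoryTheory.Limits _root_.AlgebraicGeometry
open Literature.AlgebraicGeometry.Resolution

namespace Summit.ResolutionOfSingularities.ResolutionOfSingularities.Theorems.CampaignW82

/-! ## Weak resolutions -/

/-- [OURS · L1 W8.2 door 2] replaces the role of §17 ¶2, p.89 l.59–62 (what a resolved FAMILY must restrict to
on a fibre); NOT a statement of the manuscript. A **weak resolution** of `X`: a PROPER morphism `π : Y → X` from
a REGULAR scheme `Y` (`Scheme.IsRegular`, all local rings regular) which restricts to an ISOMORPHISM over some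
NON-EMPTY open `W ⊆ X`. Compared with `IsResolution π` (proper, birational = isomorphism over a DENSE open with
dense preimage, regular source): for `X` irreducible a non-empty open is dense, but the preimage `π⁻¹(W)` need
not be dense in `Y` — `Y` may carry extra components over `X ∖ W`; discarding them (the components of a scheme
with integral local rings are open and closed) gives a resolution: for `X` irreducible and `Y` Noetherian,
`IsWeakResolution π → Scheme.HasResolution X` is the prover's
`Theorems.PrimeModelTransfer.hasResolution_of_isIso_morphismRestrict` (p483756). Conversely
`isWeakResolution_of_isResolution` (anchor, non-empty `X`). The predicate is what SPREADS in families: proper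
and smooth (⇒ regular fibres) are stable under base change and «isomorphism over `W`» restricts to
«isomorphism over the fibre of `W`», non-empty once `W` surjects onto the base — whereas density of the
preimage is not fibrewise. Vacuity: holds for `𝟙 X`, `X` non-empty regular; fails for every `π` when `X` is
empty. [folklore] -/
def IsWeakResolution {Y X : Scheme.{0}} (π : Y ⟶ X) : Prop :=
  IsProper π ∧ Scheme.IsRegular Y ∧ ∃ W : X.Opens, (W : Set X).Nonempty ∧ IsIso (π ∣_ W)

/-- A resolution of a NON-EMPTY scheme is a weak resolution (the dense open over which it is an isomorphism is
non-empty). Pure logic on the tree's `IsResolution`. [folklore] -/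
theorem isWeakResolution_of_isResolution {Y X : Scheme.{0}} [Nonempty X] (π : Y ⟶ X)
    (h : IsResolution π) : IsWeakResolution π := by
  obtain ⟨U, hUd, -, hUiso⟩ := h.isBirational
  exact ⟨h.isProper, h.isRegular, U, hUd.nonempty, hUiso⟩

/-- A weak resolution is proper (projection; anchor for instance use). [folklore] -/
theorem IsWeakResolution.isProper {Y X : Scheme.{0}} {π : Y ⟶ X} (h : IsWeakResolution π) : IsProper π :=
  h.1

/-- The source of a weak resolution is regular (projection). [folklore] -/
theorem IsWeakResolution.isRegular {Y X : Scheme.{0}} {π : Y ⟶ X} (h : IsWeakResolution π) :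
    Scheme.IsRegular Y :=
  h.2.1

/-! ## Resolution in families -/

/-- [OURS · L1 W8.2 door 2] replaces the role of §17 ¶2, p.89 l.59–62 («When the K has transcendence degree d we
can reformulate the resolution problem to the case of dimension d + dim Z» — the variety as a FAMILY over the
prime field; `S17Methodology.U89_3`) by the statement such a reformulation needs in order to return a resolution
over an ALGEBRAICALLY CLOSED ground field; NOT a statement of the manuscript. **RESOLUTION IN FAMILIES over `k`.**
For every finitely generated `k`-algebra `A` that is a domain and every PROPER morphism `f : 𝒳 → Spec A` whose
GEOMETRIC GENERIC FIBRE is integral — `𝒳 ×_{Spec A} Spec (Frac A)^{alg}` is an integral scheme, `(Frac A)^{alg}`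
being Mathlib's `AlgebraicClosure (FractionRing A)` (equivalently: `𝒳 ×_A Spec Ω` is integral for one / every
algebraically closed field `Ω` and injective `A → Ω`) — there exist
* a domain `A'` with an `A`-algebra structure whose structure map `A → A'` is INJECTIVE, of FINITE TYPE and
  ALGEBRAIC (think: a finitely generated `A`-subalgebra of `(Frac A)^{alg}` with a non-zero element inverted —
  «after shrinking the base and a generically finite base change»), and
* a scheme `𝒴` with a morphism `G : 𝒴 → 𝒳' := 𝒳 ×_{Spec A} Spec A'` (base change along `Spec A' → Spec A`),
such that for EVERY field `Ω` and EVERY ring map `φ : A' → Ω` the fibre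
`G_φ : 𝒴 ×_{𝒳'} 𝒳'_φ → 𝒳'_φ := 𝒳' ×_{Spec A'} Spec Ω` (Mathlib: `pullback.snd G (pullback.fst f' (Spec φ))`,
`f' = pullback.snd f (Spec (A → A'))` the base-changed family) is a WEAK RESOLUTION (`IsWeakResolution`: proper,
regular source, isomorphism over a non-empty open). The existential `∃ A' 𝒴 G` comes BEFORE `∀ Ω φ`: one
morphism resolves all fibres over `Spec A'` at once. Intended theorems (res-L1-s82-pv-2 gen 5, sibling files):
for prime `p`, `PrimeModelTransferAt p ↔ (∀ k` algebraically closed of characteristic `p` and algebraic over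
`𝔽_p`, resolution over `k →  FamilyResolution k)` — «⇐» by spreading a variety over an algebraically closed
`K` out as the fibre of a proper family over a finitely generated `𝔽̄_p`-subalgebra of `K` at a `K`-point that
LIFTS along the algebraic extension `A'` (`IsAlgClosed.lift`); «⇒» by descending a resolution of the geometric
generic fibre to a finite extension of `Frac A` and spreading it over a basic open (EGA IV₃ 8.10.5, IV₄ 17.7.8).
Barrier bookkeeping: the statement asks for fibrewise weak resolutions with REGULAR (in the prover's «⇒»:
smooth) fibres, i.e. for a model that is generically SMOOTH over the extended base — exactly what resolving the
total space does not give (`RegularNotGeometricallyRegular.lean`, `FrobeniusTwistResolution.lean`: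
`not_hasResolution_Spec_frobTwist`, `InseparableBaseChangeResolution.lean`); the algebraic base extension
`A → A'` is where the inseparability is absorbed. Vacuity (for `k` algebraically closed of characteristic `p`):
not trivially true (at `A = k`, `A' ≅ k` is forced up to a finite-type algebraic injective extension of a
field — a field finite over `k`, i.e. `k` itself up to isomorphism — and the fibre at `φ = (A' ≅ k)` is a weak
resolution of the given integral proper `k`-scheme: open in dimension `≥ 4`); not trivially false (implied by
`AlgClosedRes p` via the prover's «⇒»); the integrality hypothesis excludes e.g. `Spec A'' → Spec A` finite of
degree `> 1`, whose fibres admit no weak resolution. Composite characteristic: not intended. [folklore] -/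
def FamilyResolution (k : Type) [Field k] : Prop :=
  ∀ (A : Type) [CommRing A] [IsDomain A] [Algebra k A], Algebra.FiniteType k A →
    ∀ (𝒳 : Scheme.{0}) (f : 𝒳 ⟶ Spec (.of A)), IsProper f →
      IsIntegral (pullback f (Spec.map (CommRingCat.ofHom
          (algebraMap A (AlgebraicClosure (FractionRing A)))))) →
      ∃ (A' : Type) (_ : CommRing A') (_ : IsDomain A') (_ : Algebra A A'),
        Function.Injective (algebraMap A A') ∧ Algebra.FiniteType A A' ∧ Algebra.IsAlgebraic A A' ∧
        ∃ (𝒴 : Scheme.{0})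
          (G : 𝒴 ⟶ pullback f (Spec.map (CommRingCat.ofHom (algebraMap A A')))),
          ∀ (Ω : Type) [Field Ω] (φ : A' →+* Ω),
            IsWeakResolution
              (pullback.snd G
                (pullback.fst (pullback.snd f (Spec.map (CommRingCat.ofHom (algebraMap A A'))))
                  (Spec.map (CommRingCat.ofHom φ))))

/-- Anchor (pure logic): `FamilyResolution k` delivers, for a given proper family with integral geometric generic
fibres, the base extension and the simultaneous weak resolution — the `∃` unpacked once, for use by the prover's
«⇐». [folklore] -/
theorem FamilyResolution.exists_weakResolution {k : Type} [Field k] (h : FamilyResolution k)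
    (A : Type) [CommRing A] [IsDomain A] [Algebra k A] [Algebra.FiniteType k A]
    (𝒳 : Scheme.{0}) (f : 𝒳 ⟶ Spec (.of A)) [IsProper f]
    (hint : IsIntegral (pullback f (Spec.map (CommRingCat.ofHom
      (algebraMap A (AlgebraicClosure (FractionRing A))))))) :
    ∃ (A' : Type) (_ : CommRing A') (_ : IsDomain A') (_ : Algebra A A'),
      Function.Injective (algebraMap A A') ∧ Algebra.FiniteType A A' ∧ Algebra.IsAlgebraic A A' ∧
      ∃ (𝒴 : Scheme.{0})
        (G : 𝒴 ⟶ pullback f (Spec.map (CommRingCat.ofHom (algebraMap A A')))),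
        ∀ (Ω : Type) [Field Ω] (φ : A' →+* Ω),
          IsWeakResolution
            (pullback.snd G
              (pullback.fst (pullback.snd f (Spec.map (CommRingCat.ofHom (algebraMap A A'))))
                (Spec.map (CommRingCat.ofHom φ)))) :=
  h A ‹_› 𝒳 f ‹_› hint

end Summit.ResolutionOfSingularities.ResolutionOfSingularities.Theorems.CampaignW82

end
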